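import Mathlib
import Literature.MathematicalPhysics.QuantumFieldTheory.Balaban1983to89.Beta.CompositionSingular
import Literature.MathematicalPhysics.QuantumFieldTheory.Balaban1983to89.Beta.GaugeFixing

/-!
# `Balaban1983to89.Beta.GaugeFixingPropagators` — BETA sub-cell, row an2 (b2b-balaban-beta-an2, background-field route):
the LINEARISED FADDEEV–POPOV DICTIONARY AT PROPAGATOR LEVEL — slice (`δ`-function) gauge fixing versus quadratic-weight gauge
fixing versus a second slice, for the MINIMISER (background field), the EFFECTIVE FORM and the FLUCTUATION COVARIANCE read off
the bordered inverse; kernel-checked finite-dimensional linear algebra, `[folklore]` throughout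

HONEST FRAMING (cell file `HOME/BETA-SPEC.md`, verbatim): discharging `BetaPertH` makes Bałaban's UV stability
UNCONDITIONAL — a real constructive-QFT result; it is NOT the continuum limit and NOT the Clay problem.  THIS MODULE
DISCHARGES NOTHING of `FlowStep.BetaPertH` / (M2⁺) and asserts NOTHING about Bałaban's concrete lattice operators
`Δ(U)`, `Δ_π`, `Q(U)`, `R(U)D*_U`, `G`, `G′`, `H`: it proves no bound, no decay, no `k`-uniformity.  Value = kernel identity +
a typed dictionary, NOT summit progress.  It is the propagator-level companion of the tree's DETERMINANT-level module
`Beta.GaugeFixing` (unit b2b-balaban-pv25: (L0) `ξ`-independence, (L1) weight ≡ constraint, (L2) slice change, for `det kkt`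
and `logZ` only — consumed here BY NAME: `GaugeFixing.det_add_weight`, `GaugeFixing.det_kkt_add_weight`) and it is stated over
the objects of `Beta.CompositionSingular` (row an2: `flucCov`, `minOp`, `minOpL`, `effForm` = the four blocks of
`(kkt H Q)⁻¹`, `H` possibly singular — consumed by name, never restated).  It is the structural (linear-algebra) skeleton of the
an2 item (D1-rep) "agreement with an1's normalisation" of `HOME/BETA/AN2.md`: the quadratic form of the block effective action,
the background field on gauge-invariant data and the gauge-invariant two-point functions do not depend on the linearised gauge
fixing; the analytic content of (D1-rep) (which concrete operators satisfy the hypotheses, and all estimates) is NOT touched.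

CITATION HEADER (lean-in-tree rule 2026-08-18; every declaration below is tagged `[folklore]` — classical algebra of
bordered matrices / constrained quadratic minimisation; the papers are cited for ORIENTATION of the dictionary only, quoted
from the cell's x2 page renders `HOME/b2b-balaban-ref1/pages/1985-cmp99-background-propagators/…-p030…p032-x2.png`, read as
images by this seat on 2026-08-19, journal page = render page + 388):
* T. Bałaban, "Propagators for lattice gauge theories in a background field", *Comm. Math. Phys.* **99**, 389–434 (1985)
  [Balaban1985BackgroundPropagators] (cell paper B9), Sect. D.  p. 418, after (3.114)–(3.115) («Q_jDλ = D^{L^jη}_{Ū}Q′_jλ»):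
  «they imply that the averages QA are invariant with respect to gauge transformations λ satisfying Q′λ = 0, i.e. λ∈N(Q′)»
  [↦ hypothesis `Q * W = 0` below];  p. 419: «in (3.109), and in the integral (3.112), the quadratic form is restricted to A
  satisfying the gauge condition RD*A = 0. We define a new quadratic form extending ⟨A,ΔA⟩ in a gauge invariant way to all
  configurations A … ⟨A,Δ_πA⟩ = ⟨A − DG′RD*A, Δ(A − DG′RD*A)⟩. (3.119) The quadratic form is invariant with respect to gauge
  transformations determined by λ∈N(Q′) … It is obtained by gauge transforming an arbitrary configuration A to the subspace
  {A:RD*A = 0}» [↦ the gauge projection `1 − W(PW)⁻¹P` of §2b/§3b];  «We replace the operator Δ by Δ_π in (3.112), and we apply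
  the Faddeev–Popov procedure HB = Z⁻¹(B)∫dA δ(QA − B)δ_R(RD*A)e^{−½⟨A,Δ_πA⟩}A · Z′⁻¹∫dλ δ(Q′λ)e^{−½‖RD*A − Δλ‖²} = … =
  Z⁻¹(B)Z′⁻¹|det(Δ↾_{N(Q′)})|⁻¹∫dA δ(QA − B)·exp[−½⟨A,Δ_πA⟩ − ½⟨A,DRD*A⟩](A − DG′RD*A) (3.121)» [↦ slice `δ_R(RD*A)`
  versus weight `½⟨A,DRD*A⟩`: §2 and §3];  p. 420: (3.122) «G⁻¹ defined as G⁻¹ = Δ_π + DRD* + Q*aQ … A = GQ*(QGQ*)⁻¹B»,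
  (3.123) «HB = GQ*(QGQ*)⁻¹B − DG′RD*GQ*(QGQ*)⁻¹B», «We will prove that the second term in the last line vanishes. More exactly
  we will prove the identities RD*GQ* = 0, hence QGDR = 0. (3.124)», proved there by a Gaussian-integral argument (3.125), and
  «They imply the formula HB = GQ*(QGQ*)⁻¹B. (3.126)» [↦ `slice_mul_inv_mul_transpose`, `mul_inv_mul_slice_transpose`,
  `inv_mul_transpose_mul_blockProp_inv` of §3].
* T. Bałaban, "Propagators and renormalization transformations for lattice gauge theories. I", *Comm. Math. Phys.* **95**,
  17–40 (1984) [Balaban1984PropagatorsI] (cell paper B5): (1.95) «R∂*GQ* = 0, QG∂R = 0», (1.97) «R∂*G∂ = ∂*G∂R = R», «The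
  equalities (1.95), (1.97) imply that the second equation in (1.93) has the form Rλ = λ = 0» — formalised FOR THE CONCRETE
  position-space operators by the tree's `Beta.LandauMultiplierIdentities` (row an5: `R_div_G_QvAdj_eq_zero`,
  `QvOp_G_grad_R_eq_zero`, `R_div_G_grad_R`); the present file gives the ABSTRACT versions (`slice_mul_inv_mul_transpose`,
  `mul_inv_mul_slice_transpose`, `mul_inv_add_weight_mul_transpose`: `τ(H + τᵀAτ)⁻¹τᵀ = A⁻¹`) from four structural hypotheses.
* T. Bałaban, "Renormalization group approach to lattice gauge field theories. I", *Comm. Math. Phys.* **109**, 249–301 (1987)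
  [Balaban1987RG1] (cell paper B12), p. 255 (quoted in `Beta.GaugeFixing`): the Faddeev–Popov integral over the residual
  gauge group «is equal to 1» — the determinant-level statement whose propagator-level shadow is `effForm_eq_zero` below.
Orientation for the folklore (corpus, not relied on): I. Montvay, G. Münster, *Quantum Fields on a Lattice* (CUP 1994),
pp. 134–136 (lattice Faddeev–Popov procedure and gauge fixing).

THE STRUCTURAL HYPOTHESES (and nothing else is assumed): a square form `H` (two blocks) or `K` (three blocks) over a field with
NULL DIRECTIONS `W` on both sides, `H W = 0`, `Hᵀ W = 0` (linearised gauge invariance of the action); a SLICE `τ` TRANSVERSAL to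
them, `IsUnit (τ W).det` (the gauge condition fixes the gauge: `RD*·D` invertible on `N(Q′)`); in three blocks a block-averaging
constraint `Q` BLIND to them, `Q W = 0` ((3.115)); an invertible WEIGHT `A` (`½⟨A,DRD*A⟩` has `A = 1`; B12's exponential gauge
fixing has `A = α⁻¹`); and invertibility of ONE bordered matrix, `kkt H τ` resp. `kkt K [Q;τ]` (`[Q;τ] := fromRows Q τ`), i.e.
unique solvability of the slice-gauge-fixed constrained minimisation — from which the invertibility of every other bordered
matrix in play is DERIVED (`isUnit_det_add_weight`, `isUnit_det_kkt_add_weight`, `isUnit_det_kkt_sliceChange`,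
`isUnit_det_kkt_sliceChange₃`).

WHAT IS PROVED (arbitrary `Field 𝕜`; `𝒢 := flucCov`, `ℋ := minOp`, `ℋ♭ := minOpL`, `𝒮 := effForm` of `Beta.CompositionSingular`;
`X_τ := W(τW)⁻¹`, `Π_P := 1 − W(PW)⁻¹P`).
* §1 THE GAUGE SECTOR of a slice datum `(H, τ)`: `ℋ(H,τ) = X_τ` (pure gauge, `minOp_eq_gauge`), `𝒮(H,τ) = 0` (`effForm_eq_zero`:
  a gauge-invariant form minimised over a gauge slice has value zero — the propagator-level "trivial Faddeev–Popov factor"),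
  `ℋ♭(H,τ) = X_τᵀ`, `H𝒢 = 1 − τᵀX_τᵀ`, `𝒢H = 1 − X_ττ` (complementary projections: onto the annihilator of `W` along `range τᵀ`,
  onto `ker τ` along `range W`), `H𝒢H = H`, `𝒢H𝒢 = 𝒢` (a reflexive generalised inverse of the degenerate form).
* §2 WEIGHT versus SLICE, two blocks (`inv_add_weight`): `(H + τᵀAτ)⁻¹ = 𝒢(H,τ) + X_τ A⁻¹ X_τᵀ` — the weighted covariance is
  the slice covariance plus an explicit LONGITUDINAL term of rank `|ρ|`; hence `(H + τᵀAτ)⁻¹τᵀ = X_τA⁻¹`,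
  `τ(H + τᵀAτ)⁻¹ = A⁻¹X_τᵀ`, the `ξ`-IDENTITY `τ(H + τᵀAτ)⁻¹τᵀ = A⁻¹`, and `(H + τᵀAτ)⁻¹J = 𝒢(H,τ)J` for gauge-invariant
  sources `WᵀJ = 0` (`inv_add_weight_mul_of_invariant`).
* §2b SLICE CHANGE, two blocks (`kkt_mul_sliceChange_eq_one`, `kktInv_sliceChange`): for a second transversal slice `P`,
  `kkt(H,P)` is invertible and `𝒢(H,P) = Π_P 𝒢(H,τ) Π_Pᵀ` (`flucCov_sliceChange`) — change of slice = gauge transformation of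
  the covariance; `Jᵀ𝒢(H,P)J′ = Jᵀ𝒢(H,τ)J′` for invariant sources (`invariant_correlator_sliceChange`).
* §3 WEIGHT ≡ SLICE, three blocks — the main theorem `kktInv_add_weight`:
  `(kkt (K + τᵀAτ) Q)⁻¹ = [[𝒢 + X_τA⁻¹X_τᵀ, ℋ₁],[ℋ♭₁, −𝒮₁₁]]` where `𝒢, ℋ = [ℋ₁ | ℋ₂], ℋ♭, 𝒮` are the blocks of the SLICE
  system `(K, [Q;τ])` (whose gauge sector is computed first: `ℋ₂ = X_τ`, `Qℋ₁ = 1`, `τℋ₁ = 0`, `𝒮 = [[𝒮₁₁,0],[0,0]]`,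
  `(ℋ♭)₂ = X_τᵀ`, `Kℋ₁ = Qᵀ𝒮₁₁`, `K𝒢 = 1 − Qᵀℋ♭₁ − τᵀX_τᵀ`).  Consequences (`blocks_add_weight` and after):
  `minOp (K + τᵀAτ) Q = ℋ₁` and `effForm (K + τᵀAτ) Q = 𝒮₁₁` — THE BACKGROUND FIELD AND THE EFFECTIVE FORM OF THE WEIGHTED
  GAUGE FIXING ARE THOSE OF THE `δ`-SLICE GAUGE FIXING, for every invertible weight (`minOp_effForm_weight_independent`);
  `flucCov (K + τᵀAτ) Q = 𝒢 + X_τA⁻¹X_τᵀ`; conversely `ℋ(K,[Q;τ]) = [minOp (K + τᵀAτ) Q | X_τ]`,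
  `𝒮(K,[Q;τ]) = [[effForm (K + τᵀAτ) Q, 0],[0,0]]`; the weighted minimiser satisfies the gauge condition
  `τ · minOp (K + τᵀAτ) Q = 0` (`slice_mul_minOp_add_weight`, "`Rλ = λ = 0`"); the three-block `ξ`-identity
  `τ · flucCov (K + τᵀAτ) Q · τᵀ = A⁻¹`; Bałaban's (3.124) in costume: `τ (K + QᵀaQ + τᵀAτ)⁻¹ Qᵀ = 0` and
  `Q (K + QᵀaQ + τᵀAτ)⁻¹ τᵀ = 0` for every block regulator `a` (only `G⁻¹` invertible is added); and (3.126) MEETS (3.112):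
  `G Qᵀ (QGQᵀ)⁻¹ = ℋ₁` with `G = (K + QᵀaQ + τᵀAτ)⁻¹` (`inv_mul_transpose_mul_blockProp_inv`, via
  `CompositionSingular.minOp_eq_minMap` + `minOp_add_conj`) — the Landau/weighted-gauge formula for the minimal configuration
  with prescribed averages IS the `Q`-part of the `δ`-slice minimiser, for every `a` and `A`.
* §3b SLICE CHANGE, three blocks (`kkt_mul_sliceChange₃_eq_one`, `blocks_sliceChange₃`): `kkt(K,[Q;P])` is invertible,
  `𝒢(K,[Q;P]) = Π_P𝒢Π_Pᵀ`, `ℋ(K,[Q;P]) = [Π_Pℋ₁ | X_P]`, `𝒮(K,[Q;P]) = [[𝒮₁₁,0],[0,0]]`; hence the headline corollaries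
  `effForm_add_weight_sliceChange`: `effForm (K + PᵀA′P) Q = effForm (K + τᵀAτ) Q` — THE QUADRATIC FORM OF THE BLOCK EFFECTIVE
  ACTION DOES NOT DEPEND ON THE LINEARISED GAUGE FIXING (neither on the slice nor on the weight);
  `minOp_add_weight_sliceChange`: `minOp (K + PᵀA′P) Q = Π_P · minOp (K + τᵀAτ) Q` — the background field is
  gauge-transformed onto the new slice ((3.119)/(3.121): «A − DG′RD*A»); `invariant_correlator_add_weight_sliceChange`:
  `Jᵀ flucCov (K + PᵀA′P) Q J′ = Jᵀ flucCov (K + τᵀAτ) Q J′` for `WᵀJ = WᵀJ′ = 0`.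

DICTIONARY / READING (this seat's, recorded in the cell's DIVERGENCE.md as D-an2.21 — NOT a quotation, NOT a cited fact, NOT
used by any theorem): `K ↦ Δ_π` (the gauge-invariantly extended one-step form (3.118), null exactly on the linearised gauge
directions `W ↦ {Dλ : λ ∈ N(Q′)}`), `Q ↦` the block averaging `Q(U)` ((3.115) gives `QW = 0`), `τ ↦ RD*` (`τW = RD*D↾N(Q′)`
invertible = the axial gauge condition fixes the residual gauge), `A ↦ 1` for `½⟨A,DRD*A⟩` of (3.121) and `A ↦ α⁻¹·1` for B12
(0.14); then `minOp K [Q;τ]` restricted to `B`-data `↦` the δ-gauge `HB` of (3.112), `minOp (K + τᵀτ) Q ↦` the first term of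
(3.123), `minOp_add_weight ↦` "(3.123)'s second term vanishes", `effForm_add_weight_sliceChange ↦` "⟨B,(QG₁Q*)⁻¹B⟩ − a⟨B,B⟩ of
(3.156) is gauge-fixing independent", `flucCov_add_weight ↦` the fluctuation propagator `G` of (3.121) versus the δ-gauge one,
differing by the longitudinal `DG′(·)G′ᵀD*`-type term that invariant observables do not see.  Which of Bałaban's concrete
operators satisfy `K W = 0`, `Q W = 0`, `IsUnit (τW).det`, `IsUnit (kkt K [Q;τ]).det` (his Theorem on `Δ↾` positivity, (3.116))
is an ANALYTIC question about those operators, not addressed here (OBJECTS.md §5(h), §10).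

WHAT THIS FILE DOES NOT DO.  (i) It does not touch binder (D1) `hident` of
`ComposedRoad.oneLoopDrift_of_composedLegInterfacePow_identity_avg` (cell verdict BETA-SPEC v1.9zw §7.34: PRECISELY WALLED,
nothing of (M2⁺) discharged).  (ii) No norm, decay or `k`-uniform statement (B9 Theorems 3.3/3.10/3.11, the exponential
decay of `G`, `H` — untouched).  (iii) Nothing NON-linear: Bałaban's gauge fixing `δ(U(y,x))`/`exp[−α⁻¹(1 − Re tr U)]` and the
Faddeev–Popov argument act on the group-valued field; only their linearisations (slice `τ`, weight `τᵀAτ`, directions `W`)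
appear, exactly as in `Beta.GaugeFixing`.  (iv) No positivity and no reality structure is used or proved (everything holds
over any field; over ℝ with `K ≥ 0` the bordered invertibility is equivalent to `K > 0` on `ker Q ∩ ker τ`, classical, not
needed).  (v) No `def … : Prop` facts are minted (D-0026); nothing programme-internal is cited; no decl of `Beta.GaugeFixing`,
`Beta.CompositionSingular`, `Beta.KKTSplit`, `Beta.Composition` is restated — they are invoked by name.
-/

noncomputable section

namespace Literature.MathematicalPhysics.QuantumFieldTheory.Balaban1983to89.Beta.GaugeFixingPropagators

open Literature.MathematicalPhysics.QuantumFieldTheory.Balaban1983to89.Beta.Composition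
open Literature.MathematicalPhysics.QuantumFieldTheory.Balaban1983to89.Beta.CompositionSingular
open Literature.MathematicalPhysics.QuantumFieldTheory.Balaban1983to89.Beta.KKTSplit (det_kkt_add_conj)
open scoped Matrix BigOperators
open Matrix

/-! ## §1. The gauge sector of the bordered inverse of a slice datum `(H, τ)` -/

section Slice

variable {𝕜 : Type*} [Field 𝕜]
variable {α ρ : Type*} [Fintype α] [Fintype ρ] [DecidableEq α] [DecidableEq ρ]

/-- THE MINIMISER OF A SLICE DATUM IS PURE GAUGE: for a form `H` with null directions `W` (`H W = 0`) and a slice `τ`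
transversal to them (`τ W` invertible), the minimiser operator of the constrained datum `(H, τ)` is
`minOp H τ = W (τ W)⁻¹` — prescribing the slice value `τ A = y` is solved at zero cost by the gauge direction
`A = W (τW)⁻¹ y`. [folklore] -/
theorem minOp_eq_gauge (H : Matrix α α 𝕜) (τ : Matrix ρ α 𝕜) (W : Matrix α ρ 𝕜)
    (hHW : H * W = 0) (hT : IsUnit (τ * W).det) (h : IsUnit (kkt H τ).det) :
    minOp H τ = W * (τ * W)⁻¹ := by
  have h1 := congrArg (· * W) (blocks_mul_kkt H τ h).1
  simp only [Matrix.add_mul, Matrix.mul_assoc, hHW, Matrix.mul_zero, zero_add, Matrix.one_mul] at h1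
  calc minOp H τ = minOp H τ * (τ * W) * (τ * W)⁻¹ := (Matrix.mul_nonsing_inv_cancel_right _ _ hT).symm
    _ = W * (τ * W)⁻¹ := by rw [h1]

/-- THE EFFECTIVE FORM OF A SLICE DATUM VANISHES: `effForm H τ = 0` — the value of a gauge-invariant form minimised over a
gauge slice is zero (the slice variable carries no energy).  This is the propagator-level content of "the Faddeev–Popov
determinant is trivial in an axial-type gauge". [folklore] -/
theorem effForm_eq_zero (H : Matrix α α 𝕜) (τ : Matrix ρ α 𝕜) (W : Matrix α ρ 𝕜)
    (hHW : H * W = 0) (hT : IsUnit (τ * W).det) (h : IsUnit (kkt H τ).det) : effForm H τ = 0 := by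
  have hE : τᵀ * effForm H τ = 0 := by
    rw [← mul_minOp_eq H τ h, minOp_eq_gauge H τ W hHW hT h, ← Matrix.mul_assoc, hHW, Matrix.zero_mul]
  have hTt : IsUnit (τ * W)ᵀ.det := Matrix.isUnit_det_transpose _ hT
  calc effForm H τ = ((τ * W)ᵀ)⁻¹ * ((τ * W)ᵀ * effForm H τ) := (Matrix.nonsing_inv_mul_cancel_left _ _ hTt).symm
    _ = 0 := by rw [Matrix.transpose_mul, Matrix.mul_assoc, hE, Matrix.mul_zero, Matrix.mul_zero]

/-- The left companion of the minimiser of a slice datum: `Hᵀ W = 0` ⇒ `minOpL H τ = (W (τW)⁻¹)ᵀ`. [folklore] -/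
theorem minOpL_eq_gauge (H : Matrix α α 𝕜) (τ : Matrix ρ α 𝕜) (W : Matrix α ρ 𝕜)
    (hHtW : Hᵀ * W = 0) (hT : IsUnit (τ * W).det) (h : IsUnit (kkt H τ).det) :
    minOpL H τ = (W * (τ * W)⁻¹)ᵀ := by
  have hWtH : Wᵀ * H = 0 := by simpa [Matrix.transpose_mul] using congrArg Matrix.transpose hHtW
  have h1 := congrArg (Wᵀ * ·) (kkt_mul_blocks H τ h).1
  simp only [Matrix.mul_add, ← Matrix.mul_assoc, hWtH, Matrix.zero_mul, zero_add, Matrix.mul_one] at h1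
  have hTt : IsUnit (τ * W)ᵀ.det := Matrix.isUnit_det_transpose _ hT
  rw [Matrix.transpose_mul, Matrix.transpose_nonsing_inv]
  calc minOpL H τ = ((τ * W)ᵀ)⁻¹ * ((τ * W)ᵀ * minOpL H τ) := (Matrix.nonsing_inv_mul_cancel_left _ _ hTt).symm
    _ = ((τ * W)ᵀ)⁻¹ * Wᵀ := by rw [Matrix.transpose_mul, h1]

/-- `H · flucCov H τ = 1 − τᵀ (W (τW)⁻¹)ᵀ`: the form times the slice covariance is the projection ALONG `range τᵀ`
onto the annihilator of the gauge directions. [folklore] -/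
theorem mul_flucCov_eq (H : Matrix α α 𝕜) (τ : Matrix ρ α 𝕜) (W : Matrix α ρ 𝕜)
    (hHtW : Hᵀ * W = 0) (hT : IsUnit (τ * W).det) (h : IsUnit (kkt H τ).det) :
    H * flucCov H τ = 1 - τᵀ * (W * (τ * W)⁻¹)ᵀ := by
  rw [← minOpL_eq_gauge H τ W hHtW hT h, eq_sub_iff_add_eq]
  exact (kkt_mul_blocks H τ h).1

/-- `flucCov H τ · H = 1 − W (τW)⁻¹ τ`: the slice covariance times the form is the projection onto `ker τ` ALONG the
gauge directions `range W`. [folklore] -/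
theorem flucCov_mul_eq (H : Matrix α α 𝕜) (τ : Matrix ρ α 𝕜) (W : Matrix α ρ 𝕜)
    (hHW : H * W = 0) (hT : IsUnit (τ * W).det) (h : IsUnit (kkt H τ).det) :
    flucCov H τ * H = 1 - W * (τ * W)⁻¹ * τ := by
  rw [← minOp_eq_gauge H τ W hHW hT h, eq_sub_iff_add_eq]
  exact (blocks_mul_kkt H τ h).1

/-- `H · flucCov H τ · H = H`: the slice covariance is a generalised inverse of the degenerate form. [folklore] -/
theorem mul_flucCov_mul (H : Matrix α α 𝕜) (τ : Matrix ρ α 𝕜) (W : Matrix α ρ 𝕜)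
    (hHW : H * W = 0) (hT : IsUnit (τ * W).det) (h : IsUnit (kkt H τ).det) :
    H * flucCov H τ * H = H := by
  rw [Matrix.mul_assoc, flucCov_mul_eq H τ W hHW hT h, Matrix.mul_sub, Matrix.mul_one]
  simp only [← Matrix.mul_assoc, hHW, Matrix.zero_mul, sub_zero]

/-- `flucCov H τ · H · flucCov H τ = flucCov H τ` (a reflexive generalised inverse). [folklore] -/
theorem flucCov_mul_mul_flucCov (H : Matrix α α 𝕜) (τ : Matrix ρ α 𝕜) (W : Matrix α ρ 𝕜)
    (hHW : H * W = 0) (hT : IsUnit (τ * W).det) (h : IsUnit (kkt H τ).det) :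
    flucCov H τ * H * flucCov H τ = flucCov H τ := by
  rw [flucCov_mul_eq H τ W hHW hT h, Matrix.sub_mul, Matrix.one_mul]
  simp only [Matrix.mul_assoc, mul_flucCov H τ h, Matrix.mul_zero, sub_zero]

/-! ## §2. Linearised Faddeev–Popov at PROPAGATOR level (two blocks): slice `τ` versus weight `τᵀ A τ` -/

/-- The weighted form `H + τᵀ A τ` is invertible as soon as the slice datum has an invertible bordered matrix
(`GaugeFixing.det_add_weight`: `det (H + τᵀAτ) = (−1)^{|ρ|} det A · det kkt(H, τ)`). [folklore] -/
theorem isUnit_det_add_weight (H : Matrix α α 𝕜) (τ : Matrix ρ α 𝕜) (W : Matrix α ρ 𝕜) (A : Matrix ρ ρ 𝕜)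
    (hHW : H * W = 0) (hT : IsUnit (τ * W).det) (hA : IsUnit A.det) (h : IsUnit (kkt H τ).det) :
    IsUnit (H + τᵀ * A * τ).det := by
  rw [GaugeFixing.det_add_weight H τ W A hHW hT hA]
  exact ((isUnit_one.neg.pow _).mul hA).mul h

/-- PROPAGATOR-LEVEL LINEARISED FADDEEV–POPOV (two blocks).  The covariance of the WEIGHTED ("`R_ξ`-type") gauge fixing
differs from the covariance of the SLICE ("`δ`-type") gauge fixing by an explicit LONGITUDINAL term of rank `|ρ|` living in
the gauge directions: `(H + τᵀ A τ)⁻¹ = flucCov H τ + W (τW)⁻¹ A⁻¹ (W (τW)⁻¹)ᵀ`. [folklore] -/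
theorem inv_add_weight (H : Matrix α α 𝕜) (τ : Matrix ρ α 𝕜) (W : Matrix α ρ 𝕜) (A : Matrix ρ ρ 𝕜)
    (hHW : H * W = 0) (hHtW : Hᵀ * W = 0) (hT : IsUnit (τ * W).det) (hA : IsUnit A.det)
    (h : IsUnit (kkt H τ).det) :
    (H + τᵀ * A * τ)⁻¹ = flucCov H τ + W * (τ * W)⁻¹ * A⁻¹ * (W * (τ * W)⁻¹)ᵀ := by
  apply Matrix.inv_eq_right_inv
  have e1 : H * flucCov H τ = 1 - τᵀ * (W * (τ * W)⁻¹)ᵀ := mul_flucCov_eq H τ W hHtW hT h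
  have e3 : τ * (W * (τ * W)⁻¹) = 1 := by rw [← Matrix.mul_assoc, Matrix.mul_nonsing_inv _ hT]
  have e4 : H * (W * (τ * W)⁻¹ * A⁻¹ * (W * (τ * W)⁻¹)ᵀ) = 0 := by
    simp only [← Matrix.mul_assoc, hHW, Matrix.zero_mul]
  have e5 : τᵀ * A * τ * flucCov H τ = 0 := by
    simp only [Matrix.mul_assoc, mul_flucCov H τ h, Matrix.mul_zero]
  have e6 : τᵀ * A * τ * (W * (τ * W)⁻¹ * A⁻¹ * (W * (τ * W)⁻¹)ᵀ) = τᵀ * (W * (τ * W)⁻¹)ᵀ := by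
    calc τᵀ * A * τ * (W * (τ * W)⁻¹ * A⁻¹ * (W * (τ * W)⁻¹)ᵀ)
          = τᵀ * (A * ((τ * (W * (τ * W)⁻¹)) * A⁻¹)) * (W * (τ * W)⁻¹)ᵀ := by
            simp only [Matrix.mul_assoc]
      _ = τᵀ * (W * (τ * W)⁻¹)ᵀ := by rw [e3, Matrix.one_mul, Matrix.mul_nonsing_inv _ hA, Matrix.mul_one]
  rw [Matrix.add_mul, Matrix.mul_add, Matrix.mul_add, e1, e4, e5, e6, add_zero, zero_add, sub_add_cancel]

/-- Longitudinal part of the weighted covariance: `(H + τᵀAτ)⁻¹ τᵀ = W (τW)⁻¹ A⁻¹`. [folklore] -/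
theorem inv_add_weight_mul_transpose (H : Matrix α α 𝕜) (τ : Matrix ρ α 𝕜) (W : Matrix α ρ 𝕜) (A : Matrix ρ ρ 𝕜)
    (hHW : H * W = 0) (hHtW : Hᵀ * W = 0) (hT : IsUnit (τ * W).det) (hA : IsUnit A.det)
    (h : IsUnit (kkt H τ).det) :
    (H + τᵀ * A * τ)⁻¹ * τᵀ = W * (τ * W)⁻¹ * A⁻¹ := by
  have e3 : (W * (τ * W)⁻¹)ᵀ * τᵀ = 1 := by
    rw [← Matrix.transpose_mul, ← Matrix.mul_assoc, Matrix.mul_nonsing_inv _ hT, Matrix.transpose_one]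
  rw [inv_add_weight H τ W A hHW hHtW hT hA h, Matrix.add_mul, flucCov_mul_transpose H τ h, zero_add,
    Matrix.mul_assoc, e3, Matrix.mul_one]

/-- `τ (H + τᵀAτ)⁻¹ = A⁻¹ (W (τW)⁻¹)ᵀ`. [folklore] -/
theorem mul_inv_add_weight (H : Matrix α α 𝕜) (τ : Matrix ρ α 𝕜) (W : Matrix α ρ 𝕜) (A : Matrix ρ ρ 𝕜)
    (hHW : H * W = 0) (hHtW : Hᵀ * W = 0) (hT : IsUnit (τ * W).det) (hA : IsUnit A.det)
    (h : IsUnit (kkt H τ).det) :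
    τ * (H + τᵀ * A * τ)⁻¹ = A⁻¹ * (W * (τ * W)⁻¹)ᵀ := by
  rw [inv_add_weight H τ W A hHW hHtW hT hA h, Matrix.mul_add, mul_flucCov H τ h, zero_add]
  simp only [← Matrix.mul_assoc]
  rw [Matrix.mul_nonsing_inv _ hT, Matrix.one_mul]

/-- THE `ξ`-IDENTITY: `τ (H + τᵀAτ)⁻¹ τᵀ = A⁻¹` — in the weighted gauge the gauge-condition two-point function is exactly
the inverse weight, whatever `H` is. [folklore] -/
theorem mul_inv_add_weight_mul_transpose (H : Matrix α α 𝕜) (τ : Matrix ρ α 𝕜) (W : Matrix α ρ 𝕜)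
    (A : Matrix ρ ρ 𝕜) (hHW : H * W = 0) (hHtW : Hᵀ * W = 0) (hT : IsUnit (τ * W).det) (hA : IsUnit A.det)
    (h : IsUnit (kkt H τ).det) :
    τ * (H + τᵀ * A * τ)⁻¹ * τᵀ = A⁻¹ := by
  rw [Matrix.mul_assoc, inv_add_weight_mul_transpose H τ W A hHW hHtW hT hA h]
  simp only [← Matrix.mul_assoc]
  rw [Matrix.mul_nonsing_inv _ hT, Matrix.one_mul]

/-- GAUGE-INVARIANT SOURCES DO NOT SEE THE GAUGE FIXING: for `Wᵀ J = 0`, `(H + τᵀAτ)⁻¹ J = flucCov H τ · J` —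
weighted and slice covariances agree on gauge-invariant sources, for every weight `A`. [folklore] -/
theorem inv_add_weight_mul_of_invariant (H : Matrix α α 𝕜) (τ : Matrix ρ α 𝕜) (W : Matrix α ρ 𝕜)
    (A : Matrix ρ ρ 𝕜) (hHW : H * W = 0) (hHtW : Hᵀ * W = 0) (hT : IsUnit (τ * W).det) (hA : IsUnit A.det)
    (h : IsUnit (kkt H τ).det) {σ : Type*} (J : Matrix α σ 𝕜) (hJ : Wᵀ * J = 0) :
    (H + τᵀ * A * τ)⁻¹ * J = flucCov H τ * J := by
  have e : (W * (τ * W)⁻¹)ᵀ * J = 0 := by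
    rw [Matrix.transpose_mul, Matrix.mul_assoc, hJ, Matrix.mul_zero]
  rw [inv_add_weight H τ W A hHW hHtW hT hA h, Matrix.add_mul, Matrix.mul_assoc (W * (τ * W)⁻¹ * A⁻¹), e,
    Matrix.mul_zero, add_zero]


/-! ## §2b. SLICE CHANGE at propagator level (two blocks): two transversal slices `τ`, `P` -/

/-- The gauge projection onto `ker P` along the gauge directions kills `H` on the right … [folklore] -/
theorem mul_gaugeProj {β : Type*} (H : Matrix β α 𝕜) (P : Matrix ρ α 𝕜) (W : Matrix α ρ 𝕜) (hHW : H * W = 0) :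
    H * (1 - W * (P * W)⁻¹ * P) = H := by
  rw [Matrix.mul_sub, Matrix.mul_one]
  simp only [← Matrix.mul_assoc, hHW, Matrix.zero_mul, sub_zero]

/-- … is killed by the slice map `P` … [folklore] -/
theorem slice_mul_gaugeProj (P : Matrix ρ α 𝕜) (W : Matrix α ρ 𝕜) (hS : IsUnit (P * W).det) :
    P * (1 - W * (P * W)⁻¹ * P) = 0 := by
  rw [Matrix.mul_sub, Matrix.mul_one]
  simp only [← Matrix.mul_assoc]
  rw [Matrix.mul_nonsing_inv _ hS, Matrix.one_mul, sub_self]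

/-- … fixes gauge-invariant sources (transposed form) … [folklore] -/
theorem transpose_gaugeProj_mul_of_invariant (P : Matrix ρ α 𝕜) (W : Matrix α ρ 𝕜) {σ : Type*} (J : Matrix α σ 𝕜)
    (hJ : Wᵀ * J = 0) : (1 - W * (P * W)⁻¹ * P)ᵀ * J = J := by
  rw [Matrix.transpose_sub, Matrix.transpose_one, Matrix.sub_mul, Matrix.one_mul, Matrix.transpose_mul,
    Matrix.transpose_mul, Matrix.mul_assoc, Matrix.mul_assoc, hJ, Matrix.mul_zero, Matrix.mul_zero, sub_zero]

omit [DecidableEq α] in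
/-- … and maps the pure-gauge response of one slice to that of the other:
`W(PW)⁻¹P · W(τW)⁻¹ = W(τW)⁻¹`. [folklore] -/
theorem gauge_mul_slice_mul_gauge (τ P : Matrix ρ α 𝕜) (W : Matrix α ρ 𝕜) (hS : IsUnit (P * W).det) :
    W * (P * W)⁻¹ * P * (W * (τ * W)⁻¹) = W * (τ * W)⁻¹ := by
  simp only [← Matrix.mul_assoc]
  rw [Matrix.mul_assoc (W * (P * W)⁻¹) P W, Matrix.nonsing_inv_mul_cancel_right _ _ hS]

/-- SLICE CHANGE AT PROPAGATOR LEVEL (two blocks; the linearised Faddeev–Popov argument for covariances).  Two-sided null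
directions `H W = Hᵀ W = 0`, two transversal slices `τ`, `P`: the bordered inverse of `(H, P)` is obtained from the slice
covariance of `(H, τ)` by the GAUGE PROJECTION `Π_P := 1 − W (PW)⁻¹ P` onto `ker P` along the gauge directions:
`kkt(H, P) · [[Π_P 𝒢_τ Π_Pᵀ, W(PW)⁻¹],[(W(PW)⁻¹)ᵀ, 0]] = 1`. [folklore] -/
theorem kkt_mul_sliceChange_eq_one (H : Matrix α α 𝕜) (τ P : Matrix ρ α 𝕜) (W : Matrix α ρ 𝕜)
    (hHW : H * W = 0) (hHtW : Hᵀ * W = 0) (hT : IsUnit (τ * W).det) (hS : IsUnit (P * W).det)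
    (h : IsUnit (kkt H τ).det) :
    kkt H P * fromBlocks ((1 - W * (P * W)⁻¹ * P) * flucCov H τ * (1 - W * (P * W)⁻¹ * P)ᵀ)
      (W * (P * W)⁻¹) (W * (P * W)⁻¹)ᵀ 0 = 1 := by
  have ePt : (1 - W * (P * W)⁻¹ * P)ᵀ = 1 - Pᵀ * (W * (P * W)⁻¹)ᵀ := by
    rw [Matrix.transpose_sub, Matrix.transpose_one, Matrix.transpose_mul]
  have eX : (W * (τ * W)⁻¹)ᵀ * (Pᵀ * (W * (P * W)⁻¹)ᵀ) = (W * (τ * W)⁻¹)ᵀ := by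
    have := congrArg Matrix.transpose (gauge_mul_slice_mul_gauge τ P W hS)
    simpa only [Matrix.transpose_mul, Matrix.mul_assoc] using this
  have e7 : τᵀ * (W * (τ * W)⁻¹)ᵀ * (Pᵀ * (W * (P * W)⁻¹)ᵀ) = τᵀ * (W * (τ * W)⁻¹)ᵀ := by
    rw [Matrix.mul_assoc, eX]
  rw [kkt_eq_fromBlocks, fromBlocks_multiply, ← fromBlocks_one, fromBlocks_inj]
  refine ⟨?_, ?_, ?_, ?_⟩
  · rw [show H * ((1 - W * (P * W)⁻¹ * P) * flucCov H τ * (1 - W * (P * W)⁻¹ * P)ᵀ)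
          = H * (1 - W * (P * W)⁻¹ * P) * flucCov H τ * (1 - W * (P * W)⁻¹ * P)ᵀ by simp only [Matrix.mul_assoc],
      mul_gaugeProj H P W hHW, mul_flucCov_eq H τ W hHtW hT h, ePt, Matrix.sub_mul, Matrix.one_mul, Matrix.mul_sub,
      Matrix.mul_one, e7, sub_self, sub_zero, sub_add_cancel]
  · rw [← Matrix.mul_assoc, hHW, Matrix.zero_mul, Matrix.mul_zero, add_zero]
  · rw [show P * ((1 - W * (P * W)⁻¹ * P) * flucCov H τ * (1 - W * (P * W)⁻¹ * P)ᵀ)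
          = P * (1 - W * (P * W)⁻¹ * P) * flucCov H τ * (1 - W * (P * W)⁻¹ * P)ᵀ by simp only [Matrix.mul_assoc],
      slice_mul_gaugeProj P W hS, Matrix.zero_mul, Matrix.zero_mul, Matrix.zero_mul, add_zero]
  · rw [← Matrix.mul_assoc, Matrix.mul_nonsing_inv _ hS, Matrix.zero_mul, add_zero]

/-- SLICE INDEPENDENCE OF SOLVABILITY: if one transversal slice has an invertible bordered matrix, so has any other.
[folklore] -/
theorem isUnit_det_kkt_sliceChange (H : Matrix α α 𝕜) (τ P : Matrix ρ α 𝕜) (W : Matrix α ρ 𝕜)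
    (hHW : H * W = 0) (hHtW : Hᵀ * W = 0) (hT : IsUnit (τ * W).det) (hS : IsUnit (P * W).det)
    (h : IsUnit (kkt H τ).det) : IsUnit (kkt H P).det :=
  Matrix.isUnit_det_of_right_inverse (kkt_mul_sliceChange_eq_one H τ P W hHW hHtW hT hS h)

/-- The bordered inverse of the second slice in terms of the first. [folklore] -/
theorem kktInv_sliceChange (H : Matrix α α 𝕜) (τ P : Matrix ρ α 𝕜) (W : Matrix α ρ 𝕜)
    (hHW : H * W = 0) (hHtW : Hᵀ * W = 0) (hT : IsUnit (τ * W).det) (hS : IsUnit (P * W).det)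
    (h : IsUnit (kkt H τ).det) :
    (kkt H P)⁻¹ = fromBlocks ((1 - W * (P * W)⁻¹ * P) * flucCov H τ * (1 - W * (P * W)⁻¹ * P)ᵀ)
      (W * (P * W)⁻¹) (W * (P * W)⁻¹)ᵀ 0 :=
  Matrix.inv_eq_right_inv (kkt_mul_sliceChange_eq_one H τ P W hHW hHtW hT hS h)

/-- SLICE CHANGE = GAUGE TRANSFORMATION OF THE COVARIANCE: `flucCov H P = Π_P · flucCov H τ · Π_Pᵀ`,
`Π_P = 1 − W(PW)⁻¹P` ([Balaban1985BackgroundPropagators] p. 419, (3.118)–(3.119): "obtained by gauge transforming an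
arbitrary configuration to the subspace"). [folklore] -/
theorem flucCov_sliceChange (H : Matrix α α 𝕜) (τ P : Matrix ρ α 𝕜) (W : Matrix α ρ 𝕜)
    (hHW : H * W = 0) (hHtW : Hᵀ * W = 0) (hT : IsUnit (τ * W).det) (hS : IsUnit (P * W).det)
    (h : IsUnit (kkt H τ).det) :
    flucCov H P = (1 - W * (P * W)⁻¹ * P) * flucCov H τ * (1 - W * (P * W)⁻¹ * P)ᵀ := by
  have e := kktInv_sliceChange H τ P W hHW hHtW hT hS h
  rw [kktInv_eq_fromBlocks, fromBlocks_inj] at e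
  exact e.1

/-- SLICE INDEPENDENCE OF GAUGE-INVARIANT CORRELATORS: for sources annihilated by the gauge directions
(`Wᵀ J = 0`, `Wᵀ J' = 0`), `Jᵀ · flucCov H P · J' = Jᵀ · flucCov H τ · J'`. [folklore] -/
theorem invariant_correlator_sliceChange (H : Matrix α α 𝕜) (τ P : Matrix ρ α 𝕜) (W : Matrix α ρ 𝕜)
    (hHW : H * W = 0) (hHtW : Hᵀ * W = 0) (hT : IsUnit (τ * W).det) (hS : IsUnit (P * W).det)
    (h : IsUnit (kkt H τ).det) {σ σ' : Type*} (J : Matrix α σ 𝕜) (J' : Matrix α σ' 𝕜) (hJ : Wᵀ * J = 0)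
    (hJ' : Wᵀ * J' = 0) :
    Jᵀ * flucCov H P * J' = Jᵀ * flucCov H τ * J' := by
  have t1 : (1 - W * (P * W)⁻¹ * P)ᵀ * J' = J' := transpose_gaugeProj_mul_of_invariant P W J' hJ'
  have t2 : Jᵀ * (1 - W * (P * W)⁻¹ * P) = Jᵀ := by
    have := congrArg Matrix.transpose (transpose_gaugeProj_mul_of_invariant P W J hJ)
    rwa [Matrix.transpose_mul, Matrix.transpose_transpose] at this
  rw [flucCov_sliceChange H τ P W hHW hHtW hT hS h,
    show Jᵀ * ((1 - W * (P * W)⁻¹ * P) * flucCov H τ * (1 - W * (P * W)⁻¹ * P)ᵀ) * J'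
      = Jᵀ * (1 - W * (P * W)⁻¹ * P) * flucCov H τ * ((1 - W * (P * W)⁻¹ * P)ᵀ * J') by simp only [Matrix.mul_assoc],
    t1, t2]

end Slice

/-! ## §3. Three blocks: block-averaging constraint `Q`, slice `τ`, gauge directions `W` — WEIGHT ≡ SLICE for the
minimiser and the effective form -/

section ThreeBlock

variable {𝕜 : Type*} [Field 𝕜]
variable {ν μ ρ : Type*} [Fintype ν] [Fintype μ] [Fintype ρ] [DecidableEq ν] [DecidableEq μ] [DecidableEq ρ]

omit [Fintype μ] [Fintype ρ] [DecidableEq ν] [DecidableEq μ] [DecidableEq ρ] in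
/-- The stacked constraint `[Q; τ]` applied to the gauge directions: `[Q; τ] W = [0; τW]` when `Q W = 0`. [folklore] -/
theorem fromRows_mul_gauge (Q : Matrix μ ν 𝕜) (τ : Matrix ρ ν 𝕜) (W : Matrix ν ρ 𝕜) (hQW : Q * W = 0) :
    fromRows Q τ * W = fromRows 0 (τ * W) := by
  rw [fromRows_mul, hQW]

omit [Field 𝕜] [Fintype ν] [Fintype μ] [Fintype ρ] [DecidableEq ν] [DecidableEq μ] [DecidableEq ρ] in
/-- Column blocks versus corner blocks. [folklore] -/
theorem toCols₁_eq_fromRows (X : Matrix (μ ⊕ ρ) (μ ⊕ ρ) 𝕜) :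
    X.toCols₁ = fromRows X.toBlocks₁₁ X.toBlocks₂₁ := by
  ext (i | i) j <;> rfl

omit [Field 𝕜] [Fintype ν] [Fintype μ] [Fintype ρ] [DecidableEq ν] [DecidableEq μ] [DecidableEq ρ] in
/-- Column blocks versus corner blocks. [folklore] -/
theorem toCols₂_eq_fromRows (X : Matrix (μ ⊕ ρ) (μ ⊕ ρ) 𝕜) :
    X.toCols₂ = fromRows X.toBlocks₁₂ X.toBlocks₂₂ := by
  ext (i | i) j <;> rfl

omit [Field 𝕜] [Fintype ν] [Fintype μ] [Fintype ρ] [DecidableEq ν] [DecidableEq μ] [DecidableEq ρ] in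
/-- Row blocks versus corner blocks. [folklore] -/
theorem toRows₂_eq_fromCols (X : Matrix (μ ⊕ ρ) (μ ⊕ ρ) 𝕜) :
    X.toRows₂ = fromCols X.toBlocks₂₁ X.toBlocks₂₂ := by
  ext i (j | j) <;> rfl

/-- SLICE SYSTEM, minimiser, `ρ`-columns: the response to the slice value is pure gauge,
`(minOp K [Q;τ]).toCols₂ = W (τW)⁻¹`. [folklore] -/
theorem toCols₂_minOp_slice (K : Matrix ν ν 𝕜) (Q : Matrix μ ν 𝕜) (τ : Matrix ρ ν 𝕜) (W : Matrix ν ρ 𝕜)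
    (hKW : K * W = 0) (hQW : Q * W = 0) (hT : IsUnit (τ * W).det) (h : IsUnit (kkt K (fromRows Q τ)).det) :
    (minOp K (fromRows Q τ)).toCols₂ = W * (τ * W)⁻¹ := by
  have h1 := congrArg (· * W) (blocks_mul_kkt K (fromRows Q τ) h).1
  simp only [Matrix.add_mul, Matrix.mul_assoc, hKW, Matrix.mul_zero, zero_add, Matrix.one_mul, fromRows_mul,
    hQW] at h1
  rw [← fromCols_toCols (minOp K (fromRows Q τ)), fromCols_mul_fromRows, Matrix.mul_zero, zero_add] at h1
  calc (minOp K (fromRows Q τ)).toCols₂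
        = (minOp K (fromRows Q τ)).toCols₂ * (τ * W) * (τ * W)⁻¹ := (Matrix.mul_nonsing_inv_cancel_right _ _ hT).symm
    _ = W * (τ * W)⁻¹ := by rw [h1]

/-- SLICE SYSTEM, minimiser versus the two constraints: `Q ℋ₁ = 1`, `Q ℋ₂ = 0`, `τ ℋ₁ = 0` (the `Q`-minimiser satisfies the
gauge condition), `τ ℋ₂ = 1`. [folklore] -/
theorem mul_toCols_minOp_slice (K : Matrix ν ν 𝕜) (Q : Matrix μ ν 𝕜) (τ : Matrix ρ ν 𝕜)
    (h : IsUnit (kkt K (fromRows Q τ)).det) :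
    Q * (minOp K (fromRows Q τ)).toCols₁ = 1 ∧ Q * (minOp K (fromRows Q τ)).toCols₂ = 0 ∧
      τ * (minOp K (fromRows Q τ)).toCols₁ = 0 ∧ τ * (minOp K (fromRows Q τ)).toCols₂ = 1 := by
  have h1 := mul_minOp K (fromRows Q τ) h
  rw [fromRows_mul, ← fromBlocks_one, ← fromRows_fromCols_eq_fromBlocks, fromRows_ext_iff] at h1
  obtain ⟨hQ, hτ⟩ := h1
  rw [← fromCols_toCols (minOp K (fromRows Q τ)), mul_fromCols, fromCols_ext_iff] at hQ hτ
  exact ⟨hQ.1, hQ.2, hτ.1, hτ.2⟩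

/-- SLICE SYSTEM, fluctuation covariance versus the two constraints: `Q 𝒢 = 0`, `τ 𝒢 = 0`. [folklore] -/
theorem mul_flucCov_slice (K : Matrix ν ν 𝕜) (Q : Matrix μ ν 𝕜) (τ : Matrix ρ ν 𝕜)
    (h : IsUnit (kkt K (fromRows Q τ)).det) :
    Q * flucCov K (fromRows Q τ) = 0 ∧ τ * flucCov K (fromRows Q τ) = 0 := by
  have h1 := mul_flucCov K (fromRows Q τ) h
  rw [fromRows_mul, ← fromRows_zero, fromRows_ext_iff] at h1
  exact h1

/-- … and `𝒢 Qᵀ = 0`, `𝒢 τᵀ = 0`. [folklore] -/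
theorem flucCov_mul_transpose_slice (K : Matrix ν ν 𝕜) (Q : Matrix μ ν 𝕜) (τ : Matrix ρ ν 𝕜)
    (h : IsUnit (kkt K (fromRows Q τ)).det) :
    flucCov K (fromRows Q τ) * Qᵀ = 0 ∧ flucCov K (fromRows Q τ) * τᵀ = 0 := by
  have h1 := flucCov_mul_transpose K (fromRows Q τ) h
  rw [transpose_fromRows, mul_fromCols, ← fromCols_zero, fromCols_ext_iff] at h1
  exact h1

/-- SLICE SYSTEM, effective form, `ρ`-columns vanish: `(effForm K [Q;τ]).toCols₂ = 0`. [folklore] -/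
theorem toCols₂_effForm_slice (K : Matrix ν ν 𝕜) (Q : Matrix μ ν 𝕜) (τ : Matrix ρ ν 𝕜) (W : Matrix ν ρ 𝕜)
    (hKW : K * W = 0) (hQW : Q * W = 0) (hT : IsUnit (τ * W).det) (h : IsUnit (kkt K (fromRows Q τ)).det) :
    (effForm K (fromRows Q τ)).toCols₂ = 0 := by
  have h1 := congrArg (· * W) (blocks_mul_kkt K (fromRows Q τ) h).2.2.1
  simp only [Matrix.mul_assoc, hKW, Matrix.mul_zero, fromRows_mul, hQW] at h1
  rw [← fromCols_toCols (effForm K (fromRows Q τ)), fromCols_mul_fromRows, Matrix.mul_zero, zero_add] at h1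
  calc (effForm K (fromRows Q τ)).toCols₂
        = (effForm K (fromRows Q τ)).toCols₂ * (τ * W) * (τ * W)⁻¹ := (Matrix.mul_nonsing_inv_cancel_right _ _ hT).symm
    _ = 0 := by rw [← h1, Matrix.zero_mul]

/-- SLICE SYSTEM, effective form, `ρ`-rows vanish: `(effForm K [Q;τ]).toRows₂ = 0` (uses `Kᵀ W = 0`). [folklore] -/
theorem toRows₂_effForm_slice (K : Matrix ν ν 𝕜) (Q : Matrix μ ν 𝕜) (τ : Matrix ρ ν 𝕜) (W : Matrix ν ρ 𝕜)
    (hKtW : Kᵀ * W = 0) (hQW : Q * W = 0) (hT : IsUnit (τ * W).det) (h : IsUnit (kkt K (fromRows Q τ)).det) :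
    (effForm K (fromRows Q τ)).toRows₂ = 0 := by
  have hWtK : Wᵀ * K = 0 := by simpa [Matrix.transpose_mul] using congrArg Matrix.transpose hKtW
  have h1 := congrArg (Wᵀ * ·) (mul_minOp_eq K (fromRows Q τ) h)
  simp only [← Matrix.mul_assoc, hWtK, Matrix.zero_mul] at h1
  rw [← Matrix.transpose_mul, fromRows_mul_gauge Q τ W hQW, transpose_fromRows, Matrix.transpose_zero,
    ← fromRows_toRows (effForm K (fromRows Q τ)), fromCols_mul_fromRows, Matrix.zero_mul, zero_add] at h1
  have hTt : IsUnit (τ * W)ᵀ.det := Matrix.isUnit_det_transpose _ hT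
  calc (effForm K (fromRows Q τ)).toRows₂
        = ((τ * W)ᵀ)⁻¹ * ((τ * W)ᵀ * (effForm K (fromRows Q τ)).toRows₂) :=
          (Matrix.nonsing_inv_mul_cancel_left _ _ hTt).symm
    _ = 0 := by rw [← h1, Matrix.mul_zero]

/-- SLICE SYSTEM, left companion, `ρ`-rows: `(minOpL K [Q;τ]).toRows₂ = (W (τW)⁻¹)ᵀ` (uses `Kᵀ W = 0`). [folklore] -/
theorem toRows₂_minOpL_slice (K : Matrix ν ν 𝕜) (Q : Matrix μ ν 𝕜) (τ : Matrix ρ ν 𝕜) (W : Matrix ν ρ 𝕜)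
    (hKtW : Kᵀ * W = 0) (hQW : Q * W = 0) (hT : IsUnit (τ * W).det) (h : IsUnit (kkt K (fromRows Q τ)).det) :
    (minOpL K (fromRows Q τ)).toRows₂ = (W * (τ * W)⁻¹)ᵀ := by
  have hWtK : Wᵀ * K = 0 := by simpa [Matrix.transpose_mul] using congrArg Matrix.transpose hKtW
  have h1 := congrArg (Wᵀ * ·) (kkt_mul_blocks K (fromRows Q τ) h).1
  simp only [Matrix.mul_add, ← Matrix.mul_assoc, hWtK, Matrix.zero_mul, zero_add, Matrix.mul_one] at h1
  rw [← Matrix.transpose_mul, fromRows_mul_gauge Q τ W hQW, transpose_fromRows, Matrix.transpose_zero,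
    ← fromRows_toRows (minOpL K (fromRows Q τ)), fromCols_mul_fromRows, Matrix.zero_mul, zero_add] at h1
  have hTt : IsUnit (τ * W)ᵀ.det := Matrix.isUnit_det_transpose _ hT
  rw [Matrix.transpose_mul, Matrix.transpose_nonsing_inv]
  calc (minOpL K (fromRows Q τ)).toRows₂
        = ((τ * W)ᵀ)⁻¹ * ((τ * W)ᵀ * (minOpL K (fromRows Q τ)).toRows₂) :=
          (Matrix.nonsing_inv_mul_cancel_left _ _ hTt).symm
    _ = ((τ * W)ᵀ)⁻¹ * Wᵀ := by rw [h1]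

/-- The corner blocks of the slice system's effective form: only the `μ × μ` corner survives,
`effForm K [Q;τ] = fromBlocks 𝒮₁₁ 0 0 0`. [folklore] -/
theorem effForm_slice_eq_fromBlocks (K : Matrix ν ν 𝕜) (Q : Matrix μ ν 𝕜) (τ : Matrix ρ ν 𝕜) (W : Matrix ν ρ 𝕜)
    (hKW : K * W = 0) (hKtW : Kᵀ * W = 0) (hQW : Q * W = 0) (hT : IsUnit (τ * W).det)
    (h : IsUnit (kkt K (fromRows Q τ)).det) :
    effForm K (fromRows Q τ) = fromBlocks (effForm K (fromRows Q τ)).toBlocks₁₁ 0 0 0 := by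
  have hc := toCols₂_effForm_slice K Q τ W hKW hQW hT h
  have hr := toRows₂_effForm_slice K Q τ W hKtW hQW hT h
  rw [toCols₂_eq_fromRows, ← fromRows_zero, fromRows_ext_iff] at hc
  rw [toRows₂_eq_fromCols, ← fromCols_zero, fromCols_ext_iff] at hr
  conv_lhs => rw [← fromBlocks_toBlocks (effForm K (fromRows Q τ))]
  rw [hc.1, hc.2, hr.1]

/-- SLICE SYSTEM, first row of `kkt · kkt⁻¹ = 1` resolved along `[Q;τ]`:
`K 𝒢 = 1 − Qᵀ ℋ♭₁ − τᵀ (W(τW)⁻¹)ᵀ`. [folklore] -/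
theorem mul_flucCov_slice_eq (K : Matrix ν ν 𝕜) (Q : Matrix μ ν 𝕜) (τ : Matrix ρ ν 𝕜) (W : Matrix ν ρ 𝕜)
    (hKtW : Kᵀ * W = 0) (hQW : Q * W = 0) (hT : IsUnit (τ * W).det) (h : IsUnit (kkt K (fromRows Q τ)).det) :
    K * flucCov K (fromRows Q τ) =
      1 - Qᵀ * (minOpL K (fromRows Q τ)).toRows₁ - τᵀ * (W * (τ * W)⁻¹)ᵀ := by
  have := (kkt_mul_blocks K (fromRows Q τ) h).1
  rw [transpose_fromRows, ← fromRows_toRows (minOpL K (fromRows Q τ)), fromCols_mul_fromRows,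
    toRows₂_minOpL_slice K Q τ W hKtW hQW hT h] at this
  rw [sub_sub, eq_sub_iff_add_eq]; exact this

/-- SLICE SYSTEM, Euler–Lagrange resolved along `[Q;τ]`: `K ℋ₁ = Qᵀ 𝒮₁₁` — the multiplier of the slice constraint
vanishes. [folklore] -/
theorem mul_toCols₁_minOp_slice_eq (K : Matrix ν ν 𝕜) (Q : Matrix μ ν 𝕜) (τ : Matrix ρ ν 𝕜) (W : Matrix ν ρ 𝕜)
    (hKW : K * W = 0) (hKtW : Kᵀ * W = 0) (hQW : Q * W = 0) (hT : IsUnit (τ * W).det)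
    (h : IsUnit (kkt K (fromRows Q τ)).det) :
    K * (minOp K (fromRows Q τ)).toCols₁ = Qᵀ * (effForm K (fromRows Q τ)).toBlocks₁₁ := by
  have := mul_minOp_eq K (fromRows Q τ) h
  rw [← fromCols_toCols (minOp K (fromRows Q τ)), mul_fromCols, effForm_slice_eq_fromBlocks K Q τ W hKW hKtW hQW hT h,
    transpose_fromRows, fromCols_mul_fromBlocks, fromCols_ext_iff] at this
  simpa using this.1

/-- WEIGHT ≡ SLICE AT PROPAGATOR LEVEL (three blocks).  For a form `K` with null directions `W` (`K W = 0`, `Kᵀ W = 0`),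
a block-averaging constraint `Q` blind to them (`Q W = 0`), a transversal slice `τ` (`τ W` invertible) and an invertible
weight `A`: the bordered inverse of the WEIGHTED datum `(K + τᵀAτ, Q)` is read off the bordered inverse of the SLICE datum
`(K, [Q;τ])` — same minimiser (its `Q`-columns), same effective form (its `μ × μ` corner), same left companion, and a
fluctuation covariance shifted by the longitudinal term `W (τW)⁻¹ A⁻¹ (W(τW)⁻¹)ᵀ`. [folklore] -/
theorem kktInv_add_weight (K : Matrix ν ν 𝕜) (Q : Matrix μ ν 𝕜) (τ : Matrix ρ ν 𝕜) (W : Matrix ν ρ 𝕜)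
    (A : Matrix ρ ρ 𝕜) (hKW : K * W = 0) (hKtW : Kᵀ * W = 0) (hQW : Q * W = 0) (hT : IsUnit (τ * W).det)
    (hA : IsUnit A.det) (h : IsUnit (kkt K (fromRows Q τ)).det) :
    (kkt (K + τᵀ * A * τ) Q)⁻¹ =
      fromBlocks (flucCov K (fromRows Q τ) + W * (τ * W)⁻¹ * A⁻¹ * (W * (τ * W)⁻¹)ᵀ)
        (minOp K (fromRows Q τ)).toCols₁ (minOpL K (fromRows Q τ)).toRows₁
        (-(effForm K (fromRows Q τ)).toBlocks₁₁) := by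
  -- the slice-system facts
  obtain ⟨hQ1, -, hτ1, -⟩ := mul_toCols_minOp_slice K Q τ h
  obtain ⟨hQG, hτG⟩ := mul_flucCov_slice K Q τ h
  have e3 : τ * (W * (τ * W)⁻¹) = 1 := by rw [← Matrix.mul_assoc, Matrix.mul_nonsing_inv _ hT]
  have e11 := mul_flucCov_slice_eq K Q τ W hKtW hQW hT h
  have e12 := mul_toCols₁_minOp_slice_eq K Q τ W hKW hKtW hQW hT h
  have e4 : K * (W * (τ * W)⁻¹ * A⁻¹ * (W * (τ * W)⁻¹)ᵀ) = 0 := by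
    simp only [← Matrix.mul_assoc, hKW, Matrix.zero_mul]
  have e4' : Q * (W * (τ * W)⁻¹ * A⁻¹ * (W * (τ * W)⁻¹)ᵀ) = 0 := by
    simp only [← Matrix.mul_assoc, hQW, Matrix.zero_mul]
  have e5 : τᵀ * A * τ * flucCov K (fromRows Q τ) = 0 := by
    simp only [Matrix.mul_assoc, hτG, Matrix.mul_zero]
  have e5' : τᵀ * A * τ * (minOp K (fromRows Q τ)).toCols₁ = 0 := by
    simp only [Matrix.mul_assoc, hτ1, Matrix.mul_zero]
  have e6 : τᵀ * A * τ * (W * (τ * W)⁻¹ * A⁻¹ * (W * (τ * W)⁻¹)ᵀ) = τᵀ * (W * (τ * W)⁻¹)ᵀ := by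
    calc τᵀ * A * τ * (W * (τ * W)⁻¹ * A⁻¹ * (W * (τ * W)⁻¹)ᵀ)
          = τᵀ * (A * ((τ * (W * (τ * W)⁻¹)) * A⁻¹)) * (W * (τ * W)⁻¹)ᵀ := by
            simp only [Matrix.mul_assoc]
      _ = τᵀ * (W * (τ * W)⁻¹)ᵀ := by rw [e3, Matrix.one_mul, Matrix.mul_nonsing_inv _ hA, Matrix.mul_one]
  apply Matrix.inv_eq_right_inv
  rw [kkt_eq_fromBlocks, fromBlocks_multiply, ← fromBlocks_one, fromBlocks_inj]
  refine ⟨?_, ?_, ?_, ?_⟩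
  · rw [Matrix.add_mul, Matrix.mul_add, Matrix.mul_add, e11, e4, e5, e6, add_zero, zero_add]
    abel
  · rw [Matrix.add_mul, e12, e5', add_zero, Matrix.mul_neg, add_neg_cancel]
  · rw [Matrix.mul_add, hQG, e4', Matrix.zero_mul, add_zero, add_zero]
  · rw [hQ1, Matrix.zero_mul, add_zero]

/-- The weighted datum has an invertible bordered matrix (also `GaugeFixing.det_kkt_add_weight`). [folklore] -/
theorem isUnit_det_kkt_add_weight (K : Matrix ν ν 𝕜) (Q : Matrix μ ν 𝕜) (τ : Matrix ρ ν 𝕜) (W : Matrix ν ρ 𝕜)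
    (A : Matrix ρ ρ 𝕜) (hKW : K * W = 0) (hQW : Q * W = 0) (hT : IsUnit (τ * W).det)
    (hA : IsUnit A.det) (h : IsUnit (kkt K (fromRows Q τ)).det) :
    IsUnit (kkt (K + τᵀ * A * τ) Q).det := by
  rw [GaugeFixing.det_kkt_add_weight K Q τ W A hKW hQW hT hA]
  exact ((isUnit_one.neg.pow _).mul hA).mul h

/-- WEIGHT ≡ SLICE, block by block: `flucCov (K + τᵀAτ) Q = flucCov K [Q;τ] + W(τW)⁻¹A⁻¹(W(τW)⁻¹)ᵀ`,
`minOp (K + τᵀAτ) Q = (minOp K [Q;τ]).toCols₁`, `minOpL (K + τᵀAτ) Q = (minOpL K [Q;τ]).toRows₁`,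
`effForm (K + τᵀAτ) Q = (effForm K [Q;τ]).toBlocks₁₁`. [folklore] -/
theorem blocks_add_weight (K : Matrix ν ν 𝕜) (Q : Matrix μ ν 𝕜) (τ : Matrix ρ ν 𝕜) (W : Matrix ν ρ 𝕜)
    (A : Matrix ρ ρ 𝕜) (hKW : K * W = 0) (hKtW : Kᵀ * W = 0) (hQW : Q * W = 0) (hT : IsUnit (τ * W).det)
    (hA : IsUnit A.det) (h : IsUnit (kkt K (fromRows Q τ)).det) :
    flucCov (K + τᵀ * A * τ) Q = flucCov K (fromRows Q τ) + W * (τ * W)⁻¹ * A⁻¹ * (W * (τ * W)⁻¹)ᵀ ∧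
      minOp (K + τᵀ * A * τ) Q = (minOp K (fromRows Q τ)).toCols₁ ∧
      minOpL (K + τᵀ * A * τ) Q = (minOpL K (fromRows Q τ)).toRows₁ ∧
      effForm (K + τᵀ * A * τ) Q = (effForm K (fromRows Q τ)).toBlocks₁₁ := by
  have e := kktInv_add_weight K Q τ W A hKW hKtW hQW hT hA h
  rw [kktInv_eq_fromBlocks, fromBlocks_inj] at e
  exact ⟨e.1, e.2.1, e.2.2.1, neg_inj.mp e.2.2.2⟩

/-- THE MINIMISER IS THE SAME IN BOTH GAUGES (Bałaban (3.121)→(3.126) at the level of linear algebra): the minimiser of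
the weighted datum `(K + τᵀAτ, Q)` is the `Q`-part of the minimiser of the slice datum `(K, [Q;τ])`; in particular it
does not depend on the weight `A`. [folklore] -/
theorem minOp_add_weight (K : Matrix ν ν 𝕜) (Q : Matrix μ ν 𝕜) (τ : Matrix ρ ν 𝕜) (W : Matrix ν ρ 𝕜)
    (A : Matrix ρ ρ 𝕜) (hKW : K * W = 0) (hKtW : Kᵀ * W = 0) (hQW : Q * W = 0) (hT : IsUnit (τ * W).det)
    (hA : IsUnit A.det) (h : IsUnit (kkt K (fromRows Q τ)).det) :
    minOp (K + τᵀ * A * τ) Q = (minOp K (fromRows Q τ)).toCols₁ :=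
  (blocks_add_weight K Q τ W A hKW hKtW hQW hT hA h).2.1

/-- THE EFFECTIVE FORM IS THE SAME IN BOTH GAUGES: `effForm (K + τᵀAτ) Q = (effForm K [Q;τ])₁₁`; in particular it does
not depend on the weight `A`. [folklore] -/
theorem effForm_add_weight (K : Matrix ν ν 𝕜) (Q : Matrix μ ν 𝕜) (τ : Matrix ρ ν 𝕜) (W : Matrix ν ρ 𝕜)
    (A : Matrix ρ ρ 𝕜) (hKW : K * W = 0) (hKtW : Kᵀ * W = 0) (hQW : Q * W = 0) (hT : IsUnit (τ * W).det)
    (hA : IsUnit A.det) (h : IsUnit (kkt K (fromRows Q τ)).det) :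
    effForm (K + τᵀ * A * τ) Q = (effForm K (fromRows Q τ)).toBlocks₁₁ :=
  (blocks_add_weight K Q τ W A hKW hKtW hQW hT hA h).2.2.2

/-- The fluctuation covariances differ by the longitudinal term only. [folklore] -/
theorem flucCov_add_weight (K : Matrix ν ν 𝕜) (Q : Matrix μ ν 𝕜) (τ : Matrix ρ ν 𝕜) (W : Matrix ν ρ 𝕜)
    (A : Matrix ρ ρ 𝕜) (hKW : K * W = 0) (hKtW : Kᵀ * W = 0) (hQW : Q * W = 0) (hT : IsUnit (τ * W).det)
    (hA : IsUnit A.det) (h : IsUnit (kkt K (fromRows Q τ)).det) :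
    flucCov (K + τᵀ * A * τ) Q = flucCov K (fromRows Q τ) + W * (τ * W)⁻¹ * A⁻¹ * (W * (τ * W)⁻¹)ᵀ :=
  (blocks_add_weight K Q τ W A hKW hKtW hQW hT hA h).1

/-- Conversely the slice minimiser is the weighted minimiser padded by the pure-gauge response to the slice value:
`minOp K [Q;τ] = fromCols (minOp (K + τᵀAτ) Q) (W (τW)⁻¹)`. [folklore] -/
theorem minOp_slice_eq_fromCols (K : Matrix ν ν 𝕜) (Q : Matrix μ ν 𝕜) (τ : Matrix ρ ν 𝕜) (W : Matrix ν ρ 𝕜)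
    (A : Matrix ρ ρ 𝕜) (hKW : K * W = 0) (hKtW : Kᵀ * W = 0) (hQW : Q * W = 0) (hT : IsUnit (τ * W).det)
    (hA : IsUnit A.det) (h : IsUnit (kkt K (fromRows Q τ)).det) :
    minOp K (fromRows Q τ) = fromCols (minOp (K + τᵀ * A * τ) Q) (W * (τ * W)⁻¹) := by
  rw [minOp_add_weight K Q τ W A hKW hKtW hQW hT hA h, ← toCols₂_minOp_slice K Q τ W hKW hQW hT h, fromCols_toCols]

/-- … and `effForm K [Q;τ] = fromBlocks (effForm (K + τᵀAτ) Q) 0 0 0`. [folklore] -/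
theorem effForm_slice_eq (K : Matrix ν ν 𝕜) (Q : Matrix μ ν 𝕜) (τ : Matrix ρ ν 𝕜) (W : Matrix ν ρ 𝕜)
    (A : Matrix ρ ρ 𝕜) (hKW : K * W = 0) (hKtW : Kᵀ * W = 0) (hQW : Q * W = 0) (hT : IsUnit (τ * W).det)
    (hA : IsUnit A.det) (h : IsUnit (kkt K (fromRows Q τ)).det) :
    effForm K (fromRows Q τ) = fromBlocks (effForm (K + τᵀ * A * τ) Q) 0 0 0 := by
  rw [effForm_add_weight K Q τ W A hKW hKtW hQW hT hA h]
  exact effForm_slice_eq_fromBlocks K Q τ W hKW hKtW hQW hT h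

/-- WEIGHT-INDEPENDENCE (`ξ`-independence at propagator level): two invertible weights give the same minimiser and the
same effective form. [folklore] -/
theorem minOp_effForm_weight_independent (K : Matrix ν ν 𝕜) (Q : Matrix μ ν 𝕜) (τ : Matrix ρ ν 𝕜)
    (W : Matrix ν ρ 𝕜) (A A' : Matrix ρ ρ 𝕜) (hKW : K * W = 0) (hKtW : Kᵀ * W = 0) (hQW : Q * W = 0)
    (hT : IsUnit (τ * W).det) (hA : IsUnit A.det) (hA' : IsUnit A'.det) (h : IsUnit (kkt K (fromRows Q τ)).det) :
    minOp (K + τᵀ * A * τ) Q = minOp (K + τᵀ * A' * τ) Q ∧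
      effForm (K + τᵀ * A * τ) Q = effForm (K + τᵀ * A' * τ) Q := by
  rw [minOp_add_weight K Q τ W A hKW hKtW hQW hT hA h, minOp_add_weight K Q τ W A' hKW hKtW hQW hT hA' h,
    effForm_add_weight K Q τ W A hKW hKtW hQW hT hA h, effForm_add_weight K Q τ W A' hKW hKtW hQW hT hA' h]
  exact ⟨rfl, rfl⟩

/-- THE WEIGHTED MINIMISER SATISFIES THE GAUGE CONDITION: `τ · minOp (K + τᵀAτ) Q = 0` — the configuration minimising the
weighted action under the block constraint lies on the slice `τ = 0` automatically (Bałaban's "`Rλ = λ = 0`",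
[Balaban1984PropagatorsI] (1.97), in the present linear-algebra costume). [folklore] -/
theorem slice_mul_minOp_add_weight (K : Matrix ν ν 𝕜) (Q : Matrix μ ν 𝕜) (τ : Matrix ρ ν 𝕜) (W : Matrix ν ρ 𝕜)
    (A : Matrix ρ ρ 𝕜) (hKW : K * W = 0) (hKtW : Kᵀ * W = 0) (hQW : Q * W = 0) (hT : IsUnit (τ * W).det)
    (hA : IsUnit A.det) (h : IsUnit (kkt K (fromRows Q τ)).det) :
    τ * minOp (K + τᵀ * A * τ) Q = 0 := by
  rw [minOp_add_weight K Q τ W A hKW hKtW hQW hT hA h]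
  exact (mul_toCols_minOp_slice K Q τ h).2.2.1

/-- THE `ξ`-IDENTITY, three blocks: `τ · flucCov (K + τᵀAτ) Q · τᵀ = A⁻¹` — under the block constraint the
gauge-condition two-point function of the weighted gauge fixing is exactly the inverse weight. [folklore] -/
theorem slice_mul_flucCov_add_weight_mul_transpose (K : Matrix ν ν 𝕜) (Q : Matrix μ ν 𝕜) (τ : Matrix ρ ν 𝕜)
    (W : Matrix ν ρ 𝕜) (A : Matrix ρ ρ 𝕜) (hKW : K * W = 0) (hKtW : Kᵀ * W = 0) (hQW : Q * W = 0)
    (hT : IsUnit (τ * W).det) (hA : IsUnit A.det) (h : IsUnit (kkt K (fromRows Q τ)).det) :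
    τ * flucCov (K + τᵀ * A * τ) Q * τᵀ = A⁻¹ := by
  have e3 : τ * (W * (τ * W)⁻¹) = 1 := by rw [← Matrix.mul_assoc, Matrix.mul_nonsing_inv _ hT]
  have e3t : (W * (τ * W)⁻¹)ᵀ * τᵀ = 1 := by rw [← Matrix.transpose_mul, e3, Matrix.transpose_one]
  rw [flucCov_add_weight K Q τ W A hKW hKtW hQW hT hA h, Matrix.mul_add, (mul_flucCov_slice K Q τ h).2, zero_add,
    show τ * (W * (τ * W)⁻¹ * A⁻¹ * (W * (τ * W)⁻¹)ᵀ) * τᵀ = τ * (W * (τ * W)⁻¹) * A⁻¹ * ((W * (τ * W)⁻¹)ᵀ * τᵀ) by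
      simp only [Matrix.mul_assoc],
    e3, e3t, Matrix.one_mul, Matrix.mul_one]

omit [DecidableEq μ] in
/-- BAŁABAN'S (3.124) «`RD*GQ* = 0`» in linear-algebra costume: with `G := (K + QᵀaQ + τᵀAτ)⁻¹` (the form regularised in
the block directions by `a` AND gauge-fixed by the weight `A`), `τ G Qᵀ = 0`. Only `K W = Kᵀ W = 0`, `Q W = 0`, `τW` and
`A` invertible and `G⁻¹` invertible are used. [folklore] -/
theorem slice_mul_inv_mul_transpose (K : Matrix ν ν 𝕜) (Q : Matrix μ ν 𝕜) (τ : Matrix ρ ν 𝕜) (W : Matrix ν ρ 𝕜)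
    (A : Matrix ρ ρ 𝕜) (a : Matrix μ μ 𝕜) (hKW : K * W = 0) (hKtW : Kᵀ * W = 0) (hQW : Q * W = 0)
    (hT : IsUnit (τ * W).det) (hA : IsUnit A.det) (hG : IsUnit (K + Qᵀ * a * Q + τᵀ * A * τ).det) :
    τ * (K + Qᵀ * a * Q + τᵀ * A * τ)⁻¹ * Qᵀ = 0 := by
  have hHW : (K + Qᵀ * a * Q) * W = 0 := by
    rw [Matrix.add_mul, hKW, Matrix.mul_assoc, hQW, Matrix.mul_zero, add_zero]
  have hHtW : (K + Qᵀ * a * Q)ᵀ * W = 0 := by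
    rw [Matrix.transpose_add, Matrix.add_mul, hKtW, Matrix.transpose_mul, Matrix.transpose_mul,
      Matrix.transpose_transpose, Matrix.mul_assoc, Matrix.mul_assoc, hQW, Matrix.mul_zero, Matrix.mul_zero, add_zero]
  have hk : IsUnit (kkt (K + Qᵀ * a * Q) τ).det := by
    rw [GaugeFixing.det_add_weight (K + Qᵀ * a * Q) τ W A hHW hT hA] at hG
    exact isUnit_of_mul_isUnit_right hG
  have e : (W * (τ * W)⁻¹)ᵀ * Qᵀ = 0 := by
    rw [← Matrix.transpose_mul, ← Matrix.mul_assoc, hQW, Matrix.zero_mul, Matrix.transpose_zero]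
  rw [mul_inv_add_weight (K + Qᵀ * a * Q) τ W A hHW hHtW hT hA hk, Matrix.mul_assoc, e, Matrix.mul_zero]

omit [DecidableEq μ] in
/-- … «hence `QGDR = 0`»: `Q G τᵀ = 0`. [folklore] -/
theorem mul_inv_mul_slice_transpose (K : Matrix ν ν 𝕜) (Q : Matrix μ ν 𝕜) (τ : Matrix ρ ν 𝕜) (W : Matrix ν ρ 𝕜)
    (A : Matrix ρ ρ 𝕜) (a : Matrix μ μ 𝕜) (hKW : K * W = 0) (hKtW : Kᵀ * W = 0) (hQW : Q * W = 0)
    (hT : IsUnit (τ * W).det) (hA : IsUnit A.det) (hG : IsUnit (K + Qᵀ * a * Q + τᵀ * A * τ).det) :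
    Q * (K + Qᵀ * a * Q + τᵀ * A * τ)⁻¹ * τᵀ = 0 := by
  have hHW : (K + Qᵀ * a * Q) * W = 0 := by
    rw [Matrix.add_mul, hKW, Matrix.mul_assoc, hQW, Matrix.mul_zero, add_zero]
  have hHtW : (K + Qᵀ * a * Q)ᵀ * W = 0 := by
    rw [Matrix.transpose_add, Matrix.add_mul, hKtW, Matrix.transpose_mul, Matrix.transpose_mul,
      Matrix.transpose_transpose, Matrix.mul_assoc, Matrix.mul_assoc, hQW, Matrix.mul_zero, Matrix.mul_zero, add_zero]
  have hk : IsUnit (kkt (K + Qᵀ * a * Q) τ).det := by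
    rw [GaugeFixing.det_add_weight (K + Qᵀ * a * Q) τ W A hHW hT hA] at hG
    exact isUnit_of_mul_isUnit_right hG
  rw [Matrix.mul_assoc, inv_add_weight_mul_transpose (K + Qᵀ * a * Q) τ W A hHW hHtW hT hA hk]
  simp only [← Matrix.mul_assoc, hQW, Matrix.zero_mul]

/-- Invertibility of the block propagator from that of the form and of the bordered matrix. [folklore] -/
theorem isUnit_det_blockProp_of_kkt (H : Matrix ν ν 𝕜) (Q : Matrix μ ν 𝕜) (hH : IsUnit H.det)
    (h : IsUnit (kkt H Q).det) : IsUnit (blockProp H Q).det := by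
  rw [det_kkt' H Q hH] at h
  exact isUnit_of_mul_isUnit_right (isUnit_of_mul_isUnit_right h)

/-- BAŁABAN'S (3.126) «`HB = GQ*(QGQ*)⁻¹B`» MEETS THE `δ`-GAUGE MINIMISER (3.112): with `G := (K + QᵀaQ + τᵀAτ)⁻¹`,
`G Qᵀ (Q G Qᵀ)⁻¹ = (minOp K [Q;τ]).toCols₁` — the Landau-gauge minimal configuration with prescribed block averages is the
`Q`-part of the minimiser of `K` under the stacked constraint `[Q;τ]`, for every block regulator `a` and weight `A`.
[folklore] -/
theorem inv_mul_transpose_mul_blockProp_inv (K : Matrix ν ν 𝕜) (Q : Matrix μ ν 𝕜) (τ : Matrix ρ ν 𝕜)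
    (W : Matrix ν ρ 𝕜) (A : Matrix ρ ρ 𝕜) (a : Matrix μ μ 𝕜) (hKW : K * W = 0) (hKtW : Kᵀ * W = 0)
    (hQW : Q * W = 0) (hT : IsUnit (τ * W).det) (hA : IsUnit A.det) (h : IsUnit (kkt K (fromRows Q τ)).det)
    (hG : IsUnit (K + Qᵀ * a * Q + τᵀ * A * τ).det) :
    (K + Qᵀ * a * Q + τᵀ * A * τ)⁻¹ * Qᵀ * (blockProp (K + Qᵀ * a * Q + τᵀ * A * τ) Q)⁻¹ =
      (minOp K (fromRows Q τ)).toCols₁ := by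
  have hM : K + Qᵀ * a * Q + τᵀ * A * τ = K + τᵀ * A * τ + Qᵀ * a * Q := add_right_comm _ _ _
  have hk : IsUnit (kkt (K + τᵀ * A * τ) Q).det := isUnit_det_kkt_add_weight K Q τ W A hKW hQW hT hA h
  have hk' : IsUnit (kkt (K + τᵀ * A * τ + Qᵀ * a * Q) Q).det := by rwa [det_kkt_add_conj]
  have hP : IsUnit (blockProp (K + τᵀ * A * τ + Qᵀ * a * Q) Q).det :=
    isUnit_det_blockProp_of_kkt _ Q (hM ▸ hG) hk'
  rw [hM, ← minOp_eq_minMap _ Q (hM ▸ hG) hP, minOp_add_conj _ Q a hk, minOp_add_weight K Q τ W A hKW hKtW hQW hT hA h]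


/-! ## §3b. SLICE CHANGE at propagator level (three blocks): the background field is gauge-transformed, the effective
form is unchanged -/

/-- SLICE CHANGE, three blocks: the bordered inverse of `(K, [Q;P])` from the blocks of `(K, [Q;τ])` by the gauge
projection `Π_P = 1 − W(PW)⁻¹P`: covariance `Π_P 𝒢 Π_Pᵀ`, minimiser `[Π_P ℋ₁ | W(PW)⁻¹]`, effective form
`[[𝒮₁₁, 0],[0, 0]]` — `kkt(K,[Q;P]) · (that) = 1`. [folklore] -/
theorem kkt_mul_sliceChange₃_eq_one (K : Matrix ν ν 𝕜) (Q : Matrix μ ν 𝕜) (τ P : Matrix ρ ν 𝕜) (W : Matrix ν ρ 𝕜)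
    (hKW : K * W = 0) (hKtW : Kᵀ * W = 0) (hQW : Q * W = 0) (hT : IsUnit (τ * W).det) (hS : IsUnit (P * W).det)
    (h : IsUnit (kkt K (fromRows Q τ)).det) :
    kkt K (fromRows Q P) * fromBlocks
      ((1 - W * (P * W)⁻¹ * P) * flucCov K (fromRows Q τ) * (1 - W * (P * W)⁻¹ * P)ᵀ)
      (fromCols ((1 - W * (P * W)⁻¹ * P) * (minOp K (fromRows Q τ)).toCols₁) (W * (P * W)⁻¹))
      (fromRows ((minOpL K (fromRows Q τ)).toRows₁ * (1 - W * (P * W)⁻¹ * P)ᵀ) (W * (P * W)⁻¹)ᵀ)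
      (-fromBlocks (effForm K (fromRows Q τ)).toBlocks₁₁ 0 0 0) = 1 := by
  obtain ⟨hQ1, -, -, -⟩ := mul_toCols_minOp_slice K Q τ h
  obtain ⟨hQG, -⟩ := mul_flucCov_slice K Q τ h
  have e11 := mul_flucCov_slice_eq K Q τ W hKtW hQW hT h
  have e12 := mul_toCols₁_minOp_slice_eq K Q τ W hKW hKtW hQW hT h
  have ePt : (1 - W * (P * W)⁻¹ * P)ᵀ = 1 - Pᵀ * (W * (P * W)⁻¹)ᵀ := by
    rw [Matrix.transpose_sub, Matrix.transpose_one, Matrix.transpose_mul]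
  have eX : (W * (τ * W)⁻¹)ᵀ * (Pᵀ * (W * (P * W)⁻¹)ᵀ) = (W * (τ * W)⁻¹)ᵀ := by
    have := congrArg Matrix.transpose (gauge_mul_slice_mul_gauge τ P W hS)
    simpa only [Matrix.transpose_mul, Matrix.mul_assoc] using this
  have f1 : τᵀ * (W * (τ * W)⁻¹)ᵀ * (1 - W * (P * W)⁻¹ * P)ᵀ = 0 := by
    rw [ePt, Matrix.mul_sub, Matrix.mul_one, Matrix.mul_assoc, eX, sub_self]
  have hKP := mul_gaugeProj K P W hKW
  have hQP := mul_gaugeProj Q P W hQW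
  have hPP := slice_mul_gaugeProj P W hS
  have hKX : K * (W * (P * W)⁻¹) = 0 := by rw [← Matrix.mul_assoc, hKW, Matrix.zero_mul]
  have hQX : Q * (W * (P * W)⁻¹) = 0 := by rw [← Matrix.mul_assoc, hQW, Matrix.zero_mul]
  have hPX : P * (W * (P * W)⁻¹) = 1 := by rw [← Matrix.mul_assoc, Matrix.mul_nonsing_inv _ hS]
  rw [kkt_eq_fromBlocks, fromBlocks_multiply, ← fromBlocks_one, fromBlocks_inj]
  refine ⟨?_, ?_, ?_, ?_⟩
  · rw [show K * ((1 - W * (P * W)⁻¹ * P) * flucCov K (fromRows Q τ) * (1 - W * (P * W)⁻¹ * P)ᵀ)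
          = K * (1 - W * (P * W)⁻¹ * P) * flucCov K (fromRows Q τ) * (1 - W * (P * W)⁻¹ * P)ᵀ by
            simp only [Matrix.mul_assoc],
      hKP, e11, transpose_fromRows, fromCols_mul_fromRows, Matrix.sub_mul, Matrix.sub_mul, Matrix.one_mul, f1,
      sub_zero, Matrix.mul_assoc Qᵀ, ePt]
    abel
  · rw [mul_fromCols, Matrix.mul_neg, transpose_fromRows, fromCols_mul_fromBlocks,
      show K * ((1 - W * (P * W)⁻¹ * P) * (minOp K (fromRows Q τ)).toCols₁)
          = K * (1 - W * (P * W)⁻¹ * P) * (minOp K (fromRows Q τ)).toCols₁ by rw [← Matrix.mul_assoc],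
      hKP, e12, hKX]
    simp only [Matrix.mul_zero, add_zero, add_neg_cancel]
  · rw [fromRows_mul, Matrix.zero_mul, add_zero,
      show Q * ((1 - W * (P * W)⁻¹ * P) * flucCov K (fromRows Q τ) * (1 - W * (P * W)⁻¹ * P)ᵀ)
          = Q * (1 - W * (P * W)⁻¹ * P) * flucCov K (fromRows Q τ) * (1 - W * (P * W)⁻¹ * P)ᵀ by
            simp only [Matrix.mul_assoc],
      show P * ((1 - W * (P * W)⁻¹ * P) * flucCov K (fromRows Q τ) * (1 - W * (P * W)⁻¹ * P)ᵀ)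
          = P * (1 - W * (P * W)⁻¹ * P) * flucCov K (fromRows Q τ) * (1 - W * (P * W)⁻¹ * P)ᵀ by
            simp only [Matrix.mul_assoc],
      hQP, hQG, hPP]
    simp only [Matrix.zero_mul, fromRows_zero]
  · have b11 : Q * ((1 - W * (P * W)⁻¹ * P) * (minOp K (fromRows Q τ)).toCols₁) = 1 := by
      rw [← Matrix.mul_assoc, hQP, hQ1]
    have b21 : P * ((1 - W * (P * W)⁻¹ * P) * (minOp K (fromRows Q τ)).toCols₁) = 0 := by
      rw [← Matrix.mul_assoc, hPP, Matrix.zero_mul]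
    rw [fromRows_mul_fromCols, Matrix.zero_mul, add_zero, b11, hQX, b21, hPX, fromBlocks_one]

/-- SLICE INDEPENDENCE OF SOLVABILITY (three blocks). [folklore] -/
theorem isUnit_det_kkt_sliceChange₃ (K : Matrix ν ν 𝕜) (Q : Matrix μ ν 𝕜) (τ P : Matrix ρ ν 𝕜) (W : Matrix ν ρ 𝕜)
    (hKW : K * W = 0) (hKtW : Kᵀ * W = 0) (hQW : Q * W = 0) (hT : IsUnit (τ * W).det) (hS : IsUnit (P * W).det)
    (h : IsUnit (kkt K (fromRows Q τ)).det) : IsUnit (kkt K (fromRows Q P)).det :=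
  Matrix.isUnit_det_of_right_inverse (kkt_mul_sliceChange₃_eq_one K Q τ P W hKW hKtW hQW hT hS h)

/-- SLICE CHANGE, three blocks, block by block: `flucCov K [Q;P] = Π_P 𝒢 Π_Pᵀ`,
`minOp K [Q;P] = [Π_P ℋ₁ | W(PW)⁻¹]`, `minOpL K [Q;P] = [ℋ♭₁ Π_Pᵀ ; (W(PW)⁻¹)ᵀ]`, `effForm K [Q;P] = [[𝒮₁₁,0],[0,0]]`,
all blocks on the right belonging to the slice `τ`. [folklore] -/
theorem blocks_sliceChange₃ (K : Matrix ν ν 𝕜) (Q : Matrix μ ν 𝕜) (τ P : Matrix ρ ν 𝕜) (W : Matrix ν ρ 𝕜)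
    (hKW : K * W = 0) (hKtW : Kᵀ * W = 0) (hQW : Q * W = 0) (hT : IsUnit (τ * W).det) (hS : IsUnit (P * W).det)
    (h : IsUnit (kkt K (fromRows Q τ)).det) :
    flucCov K (fromRows Q P) = (1 - W * (P * W)⁻¹ * P) * flucCov K (fromRows Q τ) * (1 - W * (P * W)⁻¹ * P)ᵀ ∧
      minOp K (fromRows Q P) = fromCols ((1 - W * (P * W)⁻¹ * P) * (minOp K (fromRows Q τ)).toCols₁) (W * (P * W)⁻¹) ∧
      minOpL K (fromRows Q P) =
        fromRows ((minOpL K (fromRows Q τ)).toRows₁ * (1 - W * (P * W)⁻¹ * P)ᵀ) (W * (P * W)⁻¹)ᵀ ∧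
      effForm K (fromRows Q P) = fromBlocks (effForm K (fromRows Q τ)).toBlocks₁₁ 0 0 0 := by
  have e := Matrix.inv_eq_right_inv (kkt_mul_sliceChange₃_eq_one K Q τ P W hKW hKtW hQW hT hS h)
  rw [kktInv_eq_fromBlocks, fromBlocks_inj] at e
  exact ⟨e.1, e.2.1, e.2.2.1, neg_inj.mp e.2.2.2⟩

/-- GAUGE-FIXING INDEPENDENCE OF THE EFFECTIVE FORM (slice AND weight): for two transversal slices `τ`, `P` and two
invertible weights `A`, `A'`, `effForm (K + PᵀA'P) Q = effForm (K + τᵀAτ) Q` — the quadratic form of the block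
effective action does not depend on the (linearised) gauge fixing at all. [folklore] -/
theorem effForm_add_weight_sliceChange (K : Matrix ν ν 𝕜) (Q : Matrix μ ν 𝕜) (τ P : Matrix ρ ν 𝕜) (W : Matrix ν ρ 𝕜)
    (A A' : Matrix ρ ρ 𝕜) (hKW : K * W = 0) (hKtW : Kᵀ * W = 0) (hQW : Q * W = 0) (hT : IsUnit (τ * W).det)
    (hS : IsUnit (P * W).det) (hA : IsUnit A.det) (hA' : IsUnit A'.det) (h : IsUnit (kkt K (fromRows Q τ)).det) :
    effForm (K + Pᵀ * A' * P) Q = effForm (K + τᵀ * A * τ) Q := by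
  have h' := isUnit_det_kkt_sliceChange₃ K Q τ P W hKW hKtW hQW hT hS h
  rw [effForm_add_weight K Q P W A' hKW hKtW hQW hS hA' h', effForm_add_weight K Q τ W A hKW hKtW hQW hT hA h,
    (blocks_sliceChange₃ K Q τ P W hKW hKtW hQW hT hS h).2.2.2, toBlocks_fromBlocks₁₁]

/-- GAUGE COVARIANCE OF THE BACKGROUND FIELD: `minOp (K + PᵀA'P) Q = Π_P · minOp (K + τᵀAτ) Q` — changing the gauge
fixing gauge-transforms the minimal configuration onto the new slice ([Balaban1985BackgroundPropagators] (3.118)–(3.121):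
`A ↦ A − DG′RD*A`). [folklore] -/
theorem minOp_add_weight_sliceChange (K : Matrix ν ν 𝕜) (Q : Matrix μ ν 𝕜) (τ P : Matrix ρ ν 𝕜) (W : Matrix ν ρ 𝕜)
    (A A' : Matrix ρ ρ 𝕜) (hKW : K * W = 0) (hKtW : Kᵀ * W = 0) (hQW : Q * W = 0) (hT : IsUnit (τ * W).det)
    (hS : IsUnit (P * W).det) (hA : IsUnit A.det) (hA' : IsUnit A'.det) (h : IsUnit (kkt K (fromRows Q τ)).det) :
    minOp (K + Pᵀ * A' * P) Q = (1 - W * (P * W)⁻¹ * P) * minOp (K + τᵀ * A * τ) Q := by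
  have h' := isUnit_det_kkt_sliceChange₃ K Q τ P W hKW hKtW hQW hT hS h
  rw [minOp_add_weight K Q P W A' hKW hKtW hQW hS hA' h', minOp_add_weight K Q τ W A hKW hKtW hQW hT hA h,
    (blocks_sliceChange₃ K Q τ P W hKW hKtW hQW hT hS h).2.1, toCols₁_fromCols]

/-- GAUGE-FIXING INDEPENDENCE OF INVARIANT TWO-POINT FUNCTIONS: for sources annihilated by the gauge directions,
`Jᵀ · flucCov (K + PᵀA'P) Q · J' = Jᵀ · flucCov (K + τᵀAτ) Q · J'`. [folklore] -/
theorem invariant_correlator_add_weight_sliceChange (K : Matrix ν ν 𝕜) (Q : Matrix μ ν 𝕜) (τ P : Matrix ρ ν 𝕜)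
    (W : Matrix ν ρ 𝕜) (A A' : Matrix ρ ρ 𝕜) (hKW : K * W = 0) (hKtW : Kᵀ * W = 0) (hQW : Q * W = 0)
    (hT : IsUnit (τ * W).det) (hS : IsUnit (P * W).det) (hA : IsUnit A.det) (hA' : IsUnit A'.det)
    (h : IsUnit (kkt K (fromRows Q τ)).det) {σ σ' : Type*} (J : Matrix ν σ 𝕜) (J' : Matrix ν σ' 𝕜)
    (hJ : Wᵀ * J = 0) (hJ' : Wᵀ * J' = 0) :
    Jᵀ * flucCov (K + Pᵀ * A' * P) Q * J' = Jᵀ * flucCov (K + τᵀ * A * τ) Q * J' := by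
  have h' := isUnit_det_kkt_sliceChange₃ K Q τ P W hKW hKtW hQW hT hS h
  -- longitudinal terms do not see invariant sources
  have lP : (W * (P * W)⁻¹)ᵀ * J' = 0 := by rw [Matrix.transpose_mul, Matrix.mul_assoc, hJ', Matrix.mul_zero]
  have lτ : (W * (τ * W)⁻¹)ᵀ * J' = 0 := by rw [Matrix.transpose_mul, Matrix.mul_assoc, hJ', Matrix.mul_zero]
  have t1 : (1 - W * (P * W)⁻¹ * P)ᵀ * J' = J' := transpose_gaugeProj_mul_of_invariant P W J' hJ'
  have t2 : Jᵀ * (1 - W * (P * W)⁻¹ * P) = Jᵀ := by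
    have := congrArg Matrix.transpose (transpose_gaugeProj_mul_of_invariant P W J hJ)
    rwa [Matrix.transpose_mul, Matrix.transpose_transpose] at this
  have kP : Jᵀ * (W * (P * W)⁻¹ * A'⁻¹ * (W * (P * W)⁻¹)ᵀ) * J' = 0 := by
    rw [Matrix.mul_assoc, Matrix.mul_assoc (W * (P * W)⁻¹ * A'⁻¹), lP, Matrix.mul_zero, Matrix.mul_zero]
  have kτ : Jᵀ * (W * (τ * W)⁻¹ * A⁻¹ * (W * (τ * W)⁻¹)ᵀ) * J' = 0 := by
    rw [Matrix.mul_assoc, Matrix.mul_assoc (W * (τ * W)⁻¹ * A⁻¹), lτ, Matrix.mul_zero, Matrix.mul_zero]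
  rw [flucCov_add_weight K Q P W A' hKW hKtW hQW hS hA' h', flucCov_add_weight K Q τ W A hKW hKtW hQW hT hA h,
    (blocks_sliceChange₃ K Q τ P W hKW hKtW hQW hT hS h).1, Matrix.mul_add, Matrix.add_mul, Matrix.mul_add,
    Matrix.add_mul, kP, kτ, add_zero, add_zero,
    show Jᵀ * ((1 - W * (P * W)⁻¹ * P) * flucCov K (fromRows Q τ) * (1 - W * (P * W)⁻¹ * P)ᵀ) * J'
      = Jᵀ * (1 - W * (P * W)⁻¹ * P) * flucCov K (fromRows Q τ) * ((1 - W * (P * W)⁻¹ * P)ᵀ * J') by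
        simp only [Matrix.mul_assoc],
    t1, t2]

end ThreeBlock


end Literature.MathematicalPhysics.QuantumFieldTheory.Balaban1983to89.Beta.GaugeFixingPropagators
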